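import Literature.NumberTheory.DiophantineGeometry.ShuteFourSquarefulAssembly
import Mathlib.NumberTheory.Zsqrtd.GaussianInt
import Mathlib.RingTheory.Int.Basic
import Mathlib.Tactic.IntervalCases
import Mathlib.Algebra.Field.ZMod

/-!
# Shute (2021): the lower bound `N(B) ≫ B` and `c > 0` without Lemma 5.5

Eighth companion to `ShuteFourSquareful.lean` by this route (named fact
`Literature.NumberTheory.DiophantineGeometry.Shute2021_theorem11` = Theorem 1.1 of A. Shute,
*Sums of four squareful numbers*, arXiv:2104.06966: `N(B) = cB + O_ε(B^{734/735+ε})`, `c > 0`).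
Everything here is PROVED; no new definitions-as-facts. Main results:

* `Shute2021.le_mainCount`: `B ≤ 2¹⁶ · N(B)` for `B ≥ 16 · 722⁴ + 16`, i.e. the unconditional
  lower bound `N(B) ≫ B` of the order of magnitude asserted by Theorem 1.1
  (`Shute2021.exists_linear_le_mainCount`: `∃ c₀ > 0, ∃ B₀, ∀ B ≥ B₀, c₀ B ≤ N(B)`);
* `Shute2021.cConst_pos`: under Prop. 3.1 and the circle-method input of
  `ShuteFourSquarefulAssembly.lean` (the shapes of Theorem 4.2 and Lemma 4.15) the constant
  `c = cConst 𝔠` (the corrected (5.10)) is positive — so the hypothesis `0 < cConst 𝔠` of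
  `Shute2021.theorem11_of_circleMethod` (Lemma 5.5 of the source, proved there from the local
  densities of §4–§5) is discharged: `Shute2021.theorem11_of_circleMethod'
  (h31 : Shute2021_prop31) (𝔠) (h1 : CoeffBound 𝔠) (h2 : CircleMethodInput 𝔠) :
  Shute2021_theorem11`, and the same from `Shute2021_prop32`
  (`Shute2021.theorem11_of_prop32_and_circleMethod'`).

With the companions this leaves exactly §4 (Heath-Brown's `δ`-method: Theorem 4.2, Lemma 4.15)
and Prop. 3.2 (printed proof incomplete, see `ShuteFourSquareful.lean`) un-formalized on the way
to Theorem 1.1.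

The lower bound is NOT the paper's argument (which obtains `c > 0` as a product of local
densities, Lemma 5.5); it is a direct count inside the single fibre `𝐲 = (1, -1, 1, 1)` of (1.5):
the vectors `𝐳 = (x₁², -x₂², x₃², x₄²)` with `x₁² + x₃² + x₄² = x₂²` (Pythagorean quadruples) are
squareful, sum to zero and have `z₁z₂z₃z₄ = -(x₁x₂x₃x₄)² ≠ □`. They are produced by the classical
(Euler–Lebesgue) parametrization through Gaussian integers `β = (2a₁+1) + 2a₂ i`,
`γ = (2b₁+1) + 2b₂ i`, `(a, b) ∈ [-T, T]⁴`: `x₂ - x₁ = N(β)`, `x₂ + x₁ = N(γ)`,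
`x₃ + i x₄ = βγ` (`Shute2021.pyth`). On the parameters with `gcd(N(β), N(γ)) = 1` and
`x₁, x₄ ≠ 0` (`Shute2021.good`):
* `𝐳` is primitive and lies in the set counted by `N(B)` once `16(2T+1)⁴ ≤ B`
  (`Shute2021.zvec_pyth_mem_mainSet`);
* the parametrization is `4`-to-`1` (`Shute2021.exists_unit_of_mul_eq`: `N(β') = N(β)`,
  `N(γ') = N(γ)`, `β'γ' = βγ` force `β' = εβ`, `γ' = ε̄γ` for a unit `ε`, using only that
  `N(β)` is coprime to `γ'` in `ℤ[i]`), and `𝐱 ↦ 𝐳` is `16`-to-`1`, so `#good(T) ≤ 64 N(B)`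
  (`Shute2021.card_good_le_mainCount`);
* a first-order sieve shows `#good(T) ≥ (2T+1)⁴/4` for `T ≥ 360`
  (`Shute2021.pow_four_le_card_good`): a bad parameter has `x₁ = 0` (`≤ 2W³`, `W = 2T+1`),
  `x₄ = 0` (`≤ W³`), or a common prime factor `P` of the two (odd) norms; for `P = 3` at most
  `(W/3+1)⁴`, for `5 ≤ P ≤ 2W` at most `(2W(W/P+1))²` (at most two square roots mod `P` and at
  most `W/P + 1` elements of `[-T, T]` in a residue class), and for `P > 2W` at most `2W³` in total
  (such a prime factor of a norm `≤ 2W²` is unique); with `(W/P+1)² ≤ (5/4)(W/P)² + 5` and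
  `Σ_{P ≥ 5 prime} 1/P² < Σ_{k ≥ 0} 1/(4(k+2)(k+3)) = 1/8` the bad set has at most
  `(11/16)W⁴ + 45W³` elements.
Finally `0 < c` follows from `|N(B) - cB| ≤ C B^θ` (`θ < 1`) and `N(B) ≥ c₀B`
(`Shute2021.pos_of_asymptotic`).

## References

* A. Shute, *Sums of four squareful numbers*, arXiv:2104.06966v1 [math.NT] (2021), Theorem 1.1,
  (1.5), §5 Lemma 5.5 and (5.10). [Shute2021]
-/

open Finset

namespace Literature.NumberTheory.DiophantineGeometry

namespace Shute2021

open Zsqrtd GaussianInt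

/-- The Gaussian integer `(2a₁ + 1) + 2a₂ i` (odd real part, even imaginary part) attached to a
parameter pair `a = (a₁, a₂)`. [folklore] -/
def gauss (a : ℤ × ℤ) : GaussianInt := ⟨2 * a.1 + 1, 2 * a.2⟩

/-- Its norm `(2a₁+1)² + (2a₂)² ≡ 1 (mod 4)`. [folklore] -/
def nrm (a : ℤ × ℤ) : ℤ := (2 * a.1 + 1) ^ 2 + (2 * a.2) ^ 2

/-- `N(gauss a) = nrm a`. [folklore] -/
theorem norm_gauss (a : ℤ × ℤ) : (gauss a).norm = nrm a := by
  rw [Zsqrtd.norm_def]; simp [gauss, nrm]; ring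

/-- The norm is positive (the real part `2a₁+1` is odd). [folklore] -/
theorem nrm_pos (a : ℤ × ℤ) : 0 < nrm a := by
  unfold nrm
  have h : (2 * a.1 + 1) ≠ 0 := by omega
  positivity

/-- `gauss a ≠ 0`. [folklore] -/
theorem gauss_ne_zero (a : ℤ × ℤ) : gauss a ≠ 0 := by
  intro h
  have := congrArg Zsqrtd.re h
  simp [gauss] at this
  omega

/-- The Pythagorean quadruple `𝐱 = (x₁, x₂, x₃, x₄)`, `x₁² + x₃² + x₄² = x₂²`, attached to a pair of
parameter pairs `(a, b)`: `x₂ - x₁ = N(β)`, `x₂ + x₁ = N(γ)`, `x₃ + i x₄ = βγ` for `β = gauss a`,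
`γ = gauss b` (the Euler–Lebesgue parametrization). [folklore] -/
def pyth (p : (ℤ × ℤ) × (ℤ × ℤ)) : Fin 4 → ℤ :=
  ![2 * (p.2.1 ^ 2 + p.2.1 + p.2.2 ^ 2 - p.1.1 ^ 2 - p.1.1 - p.1.2 ^ 2),
    2 * (p.1.1 ^ 2 + p.1.1 + p.1.2 ^ 2 + p.2.1 ^ 2 + p.2.1 + p.2.2 ^ 2) + 1,
    (2 * p.1.1 + 1) * (2 * p.2.1 + 1) - 4 * p.1.2 * p.2.2,
    (2 * p.1.1 + 1) * (2 * p.2.2) + 2 * p.1.2 * (2 * p.2.1 + 1)]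

/-- `x₂ - x₁ = N(β)`. [folklore] -/
theorem pyth_one_sub_pyth_zero (p : (ℤ × ℤ) × (ℤ × ℤ)) : pyth p 1 - pyth p 0 = nrm p.1 := by
  simp [pyth, nrm]; ring

/-- `x₂ + x₁ = N(γ)`. [folklore] -/
theorem pyth_one_add_pyth_zero (p : (ℤ × ℤ) × (ℤ × ℤ)) : pyth p 1 + pyth p 0 = nrm p.2 := by
  simp [pyth, nrm]; ring

/-- `x₃ = Re(βγ)`. [folklore] -/
theorem pyth_two_eq (p : (ℤ × ℤ) × (ℤ × ℤ)) : pyth p 2 = (gauss p.1 * gauss p.2).re := by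
  simp [pyth, gauss]; ring

/-- `x₄ = Im(βγ)`. [folklore] -/
theorem pyth_three_eq (p : (ℤ × ℤ) × (ℤ × ℤ)) : pyth p 3 = (gauss p.1 * gauss p.2).im := by
  simp [pyth, gauss]

/-- The Pythagorean relation `x₁² + x₃² + x₄² = x₂²`. [folklore] -/
theorem pyth_rel (p : (ℤ × ℤ) × (ℤ × ℤ)) :
    pyth p 0 ^ 2 + pyth p 2 ^ 2 + pyth p 3 ^ 2 = pyth p 1 ^ 2 := by
  simp [pyth]; ring

/-- `x₂ > 0`. [folklore] -/
theorem pyth_one_pos (p : (ℤ × ℤ) × (ℤ × ℤ)) : 0 < pyth p 1 := by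
  have h1 := pyth_one_sub_pyth_zero p
  have h2 := pyth_one_add_pyth_zero p
  have := nrm_pos p.1
  have := nrm_pos p.2
  omega

/-- `x₃` is odd, hence nonzero. [folklore] -/
theorem pyth_two_ne_zero (p : (ℤ × ℤ) × (ℤ × ℤ)) : pyth p 2 ≠ 0 := by
  have h : pyth p 2 = 2 * (2 * p.1.1 * p.2.1 + p.1.1 + p.2.1 - 2 * p.1.2 * p.2.2) + 1 := by
    simp [pyth]; ring
  omega

/-- The squareful vector `𝐳 = (x₁², -x₂², x₃², x₄²)` (the fibre `𝐲 = (1, -1, 1, 1)` of (1.5)).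
[folklore] -/
def zvec (x : Fin 4 → ℤ) : Fin 4 → ℤ := ![x 0 ^ 2, -x 1 ^ 2, x 2 ^ 2, x 3 ^ 2]

/-- `z₁ + z₂ + z₃ + z₄ = 0` (the Pythagorean relation). [folklore] -/
theorem sum_zvec_pyth (p : (ℤ × ℤ) × (ℤ × ℤ)) : ∑ i, zvec (pyth p) i = 0 := by
  have := pyth_rel p
  simp [zvec, Fin.sum_univ_four]
  linarith

/-- `z₁z₂z₃z₄ = -(x₁x₂x₃x₄)²`. [folklore] -/
theorem prod_zvec (x : Fin 4 → ℤ) : ∏ i, zvec x i = -(x 0 * x 1 * x 2 * x 3) ^ 2 := by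
  simp [zvec, Fin.prod_univ_four]; ring

open Classical in
/-- The finite set counted by `mainCount B`. [cite: Shute2021, §1, (1.1)–(1.3)] -/
noncomputable def mainSet (B : ℕ) : Finset (Fin 4 → ℤ) :=
  {z ∈ box (fun _ => B) |
      (∀ i, IsSquareful (z i)) ∧ IsPrimitive z ∧ ∑ i, z i = 0 ∧ ¬ IsSquare (∏ i, z i)}

/-- `N(B) = #mainSet(B)`. [cite: Shute2021, §1, (1.1)–(1.3)] -/
theorem mainCount_eq_card_mainSet (B : ℕ) : mainCount B = #(mainSet B) := rfl

/-- The parameter box `[-T, T]⁴`, as pairs of pairs `(a, b) = ((a₁, a₂), (b₁, b₂))`. [folklore] -/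
noncomputable def pbox (T : ℕ) : Finset ((ℤ × ℤ) × (ℤ × ℤ)) :=
  (Icc (-(T : ℤ)) T ×ˢ Icc (-(T : ℤ)) T) ×ˢ (Icc (-(T : ℤ)) T ×ˢ Icc (-(T : ℤ)) T)

/-- The good parameters: coprime norms `gcd(N(β), N(γ)) = 1` and `x₁ ≠ 0`, `x₄ ≠ 0`. [folklore] -/
noncomputable def good (T : ℕ) : Finset ((ℤ × ℤ) × (ℤ × ℤ)) :=
  {p ∈ pbox T | Int.gcd (nrm p.1) (nrm p.2) = 1 ∧ pyth p 0 ≠ 0 ∧ pyth p 3 ≠ 0}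

/-- A nonzero square is squareful. [folklore] -/
theorem isSquareful_sq {x : ℤ} (hx : x ≠ 0) : IsSquareful (x ^ 2) := by
  simpa using isSquareful_pow_three_mul_sq hx one_ne_zero

/-- Minus a nonzero square is squareful. [folklore] -/
theorem isSquareful_neg_sq {x : ℤ} (hx : x ≠ 0) : IsSquareful (-x ^ 2) := by
  have := isSquareful_pow_three_mul_sq hx (neg_ne_zero.2 one_ne_zero)
  simpa using this

/-- Primitivity of `𝐳` from the coprimality of the norms. [folklore] -/
theorem isPrimitive_zvec_pyth {p : (ℤ × ℤ) × (ℤ × ℤ)} (hcop : Int.gcd (nrm p.1) (nrm p.2) = 1) :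
    IsPrimitive (zvec (pyth p)) := by
  intro d hd
  by_contra hd1
  have h0 : zvec (pyth p) 1 ≠ 0 := by
    have := pyth_one_pos p
    simp [zvec]; positivity
  have hdne : d ≠ 0 := by
    rintro rfl
    exact h0 (by simpa using hd 1)
  obtain ⟨q, hq, hqd⟩ := Nat.exists_prime_and_dvd hd1
  have hq' : Prime (q : ℤ) := Int.prime_iff_natAbs_prime.2 (by simpa using hq)
  have hx0 : (q : ℤ) ∣ pyth p 0 := by
    have : (q : ℤ) ∣ zvec (pyth p) 0 := (Int.natCast_dvd_natCast.2 hqd).trans (hd 0)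
    simp [zvec] at this
    exact hq'.dvd_of_dvd_pow this
  have hx1 : (q : ℤ) ∣ pyth p 1 := by
    have : (q : ℤ) ∣ zvec (pyth p) 1 := (Int.natCast_dvd_natCast.2 hqd).trans (hd 1)
    simp [zvec] at this
    exact hq'.dvd_of_dvd_pow this
  have hu : (q : ℤ) ∣ nrm p.1 := by rw [← pyth_one_sub_pyth_zero]; exact dvd_sub hx1 hx0
  have hv : (q : ℤ) ∣ nrm p.2 := by rw [← pyth_one_add_pyth_zero]; exact dvd_add hx1 hx0
  have : (q : ℤ) ∣ (Int.gcd (nrm p.1) (nrm p.2) : ℤ) := Int.dvd_coe_gcd hu hv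
  rw [hcop] at this
  exact hq.one_lt.ne' (by exact_mod_cast Int.eq_one_of_dvd_one (by positivity) this)

/-- `t ∈ [-T, T] ⟹ |t| ≤ T`. [folklore] -/
theorem abs_le_of_mem_Icc {T : ℕ} {t : ℤ} (ht : t ∈ Icc (-(T : ℤ)) T) : |t| ≤ T := by
  rw [mem_Icc] at ht; exact abs_le.2 ⟨ht.1, ht.2⟩

/-- Size: for `(a, b) ∈ pbox T`, every `|xᵢ| ≤ 2 (2T+1)²`. [folklore] -/
theorem abs_pyth_le {T : ℕ} {p : (ℤ × ℤ) × (ℤ × ℤ)} (hp : p ∈ pbox T) (i : Fin 4) :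
    |pyth p i| ≤ 2 * (2 * T + 1) ^ 2 := by
  simp only [pbox, mem_product] at hp
  obtain ⟨⟨h1, h2⟩, h3, h4⟩ := hp
  rw [mem_Icc] at h1 h2 h3 h4
  have e1 : (2 * p.1.1 + 1) ^ 2 ≤ (2 * (T : ℤ) + 1) ^ 2 := by nlinarith
  have e2 : (2 * p.1.2) ^ 2 ≤ (2 * (T : ℤ) + 1) ^ 2 := by nlinarith
  have e3 : (2 * p.2.1 + 1) ^ 2 ≤ (2 * (T : ℤ) + 1) ^ 2 := by nlinarith
  have e4 : (2 * p.2.2) ^ 2 ≤ (2 * (T : ℤ) + 1) ^ 2 := by nlinarith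
  have hu : nrm p.1 ≤ 2 * (2 * (T : ℤ) + 1) ^ 2 := by unfold nrm; linarith
  have hv : nrm p.2 ≤ 2 * (2 * (T : ℤ) + 1) ^ 2 := by unfold nrm; linarith
  have hu0 := nrm_pos p.1
  have hv0 := nrm_pos p.2
  have k1 := pyth_one_sub_pyth_zero p
  have k2 := pyth_one_add_pyth_zero p
  have hrel := pyth_rel p
  rw [abs_le]
  fin_cases i
  · simp only [Fin.zero_eta, Fin.isValue]; constructor <;> linarith
  · simp only [Fin.mk_one, Fin.isValue]; constructor <;> linarith
  · simp only [Fin.reduceFinMk, Fin.isValue]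
    have hx1 : pyth p 1 ^ 2 ≤ (2 * (2 * (T : ℤ) + 1) ^ 2) ^ 2 := by nlinarith
    constructor <;> nlinarith
  · simp only [Fin.reduceFinMk, Fin.isValue]
    have hx1 : pyth p 1 ^ 2 ≤ (2 * (2 * (T : ℤ) + 1) ^ 2) ^ 2 := by nlinarith
    constructor <;> nlinarith

/-- **Membership**: for good parameters and `16 (2T+1)⁴ ≤ B`, `𝐳 ∈ mainSet B` (the fibre
`𝐲 = (1, -1, 1, 1)` of (1.5)). [cite: Shute2021, §1, (1.1)–(1.5)] -/
theorem zvec_pyth_mem_mainSet {T B : ℕ} (hB : 4 * (2 * (2 * T + 1) ^ 2) ^ 2 ≤ B)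
    {p : (ℤ × ℤ) × (ℤ × ℤ)} (hp : p ∈ good T) : zvec (pyth p) ∈ mainSet B := by
  classical
  simp only [good, mem_filter] at hp
  obtain ⟨hbox, hcop, hx0, hx3⟩ := hp
  have hx1 : pyth p 1 ≠ 0 := (pyth_one_pos p).ne'
  have hx2 : pyth p 2 ≠ 0 := pyth_two_ne_zero p
  unfold mainSet
  rw [mem_filter]
  refine ⟨?_, ?_, isPrimitive_zvec_pyth hcop, sum_zvec_pyth p, ?_⟩
  · rw [mem_box]
    intro i
    have key : ∀ j, |pyth p j ^ 2| ≤ (B : ℤ) := by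
      intro j
      have h := abs_pyth_le hbox j
      have hB' : (4 * (2 * (2 * (T : ℤ) + 1) ^ 2) ^ 2) ≤ (B : ℤ) := by exact_mod_cast hB
      rw [abs_pow]  
      have h0 : 0 ≤ |pyth p j| := abs_nonneg _
      nlinarith
    fin_cases i
    · simpa [zvec] using key 0
    · simpa [zvec, abs_neg] using key 1
    · simpa [zvec] using key 2
    · simpa [zvec] using key 3
  · intro i
    fin_cases i
    · exact isSquareful_sq hx0
    · exact isSquareful_neg_sq hx1
    · exact isSquareful_sq hx2
    · exact isSquareful_sq hx3
  · rw [prod_zvec]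
    intro hsq
    have hne : pyth p 0 * pyth p 1 * pyth p 2 * pyth p 3 ≠ 0 := by positivity
    have hlt : -(pyth p 0 * pyth p 1 * pyth p 2 * pyth p 3) ^ 2 < 0 := by
      have := pow_pos (abs_pos.2 hne) 2
      rw [← sq_abs]; linarith
    obtain ⟨r, hr⟩ := hsq
    nlinarith [hr, mul_self_nonneg r]


/-! ### Fibres of the parametrization -/

/-- A Gaussian integer of norm `1` is one of `±1, ±i`. [folklore] -/
def units4 : Finset GaussianInt := {1, -1, ⟨0, 1⟩, ⟨0, -1⟩}

/-- `#{±1, ±i} ≤ 4`. [folklore] -/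
theorem card_units4_le : #units4 ≤ 4 := by
  unfold units4
  refine (card_insert_le _ _).trans ?_
  refine Nat.succ_le_succ ((card_insert_le _ _).trans (Nat.succ_le_succ ((card_insert_le _ _).trans ?_)))
  simp

/-- A Gaussian integer of norm `1` is one of `±1, ±i`. [folklore] -/
theorem mem_units4_of_norm_eq_one {ε : GaussianInt} (h : ε.norm = 1) : ε ∈ units4 := by
  obtain ⟨a, b⟩ := ε
  rw [Zsqrtd.norm_def] at h
  simp only at h
  have h1 : a * a + b * b = 1 := by linarith
  have h2 : a ≤ 1 := by nlinarith
  have h3 : -1 ≤ a := by nlinarith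
  have h4 : b ≤ 1 := by nlinarith
  have h5 : -1 ≤ b := by nlinarith
  simp only [units4, mem_insert, mem_singleton, Zsqrtd.ext_iff]
  interval_cases a <;> interval_cases b <;> simp_all

/-- **Rigidity of the parametrization.** If `N(β') = N(β)`, `N(γ') = N(γ)`, `β'γ' = βγ` and the
norms `N(β)`, `N(γ)` are coprime, then `β' = εβ`, `γ' = ε̄γ` for a unit `ε`. [folklore] -/
theorem exists_unit_of_mul_eq {β β' γ γ' : GaussianInt} (hβ : β ≠ 0)
    (hcop : IsCoprime β.norm γ.norm) (hNβ : β'.norm = β.norm) (hNγ : γ'.norm = γ.norm)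
    (hprod : β' * γ' = β * γ) :
    ∃ ε : GaussianInt, ε.norm = 1 ∧ β' = ε * β ∧ γ' = star ε * γ := by
  obtain ⟨a, b, hab⟩ := hcop
  -- coprimality of `N(β)` and `γ'` inside `ℤ[i]`
  have hcop' : IsCoprime ((β.norm : ℤ) : GaussianInt) γ' := by
    refine ⟨(a : GaussianInt), (b : GaussianInt) * star γ', ?_⟩
    have e1 : ((γ.norm : ℤ) : GaussianInt) = γ' * star γ' := by
      rw [← hNγ]; exact Zsqrtd.norm_eq_mul_conj γ'
    have : ((a * β.norm + b * γ.norm : ℤ) : GaussianInt) = 1 := by rw [hab]; simp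
    calc (a : GaussianInt) * (β.norm : ℤ) + (b : GaussianInt) * star γ' * γ'
        = (a : GaussianInt) * (β.norm : ℤ) + (b : GaussianInt) * (γ' * star γ') := by ring
      _ = ((a * β.norm + b * γ.norm : ℤ) : GaussianInt) := by rw [← e1]; push_cast; ring
      _ = 1 := this
  have hNb : ((β.norm : ℤ) : GaussianInt) = β * star β := Zsqrtd.norm_eq_mul_conj β
  have hdvd : ((β.norm : ℤ) : GaussianInt) ∣ γ' * (β' * star β) := by
    refine ⟨γ, ?_⟩
    calc γ' * (β' * star β) = (β' * γ') * star β := by ring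
      _ = β * γ * star β := by rw [hprod]
      _ = (β.norm : ℤ) * γ := by rw [hNb]; ring
  obtain ⟨ε, hε⟩ := hcop'.dvd_of_dvd_mul_left hdvd
  have hN0 : (β.norm : ℤ) ≠ 0 := by
    rw [Ne, Zsqrtd.norm_eq_zero_iff (by norm_num) β]; exact hβ
  have hN0' : ((β.norm : ℤ) : GaussianInt) ≠ 0 := by exact_mod_cast hN0
  -- norms: `N(ε) = 1`
  have hnormε : ε.norm = 1 := by
    have h1 := congrArg Zsqrtd.norm hε
    rw [Zsqrtd.norm_mul, Zsqrtd.norm_mul, Zsqrtd.norm_conj, Zsqrtd.norm_intCast, hNβ] at h1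
    have h2 : β.norm * β.norm * (ε.norm - 1) = 0 := by linarith
    rcases mul_eq_zero.1 h2 with h3 | h3
    · exact absurd (mul_self_eq_zero.1 h3) hN0
    · linarith
  have hβ' : β' = ε * β := by
    have h1 : β' * ((β.norm : ℤ) : GaussianInt) = ((β.norm : ℤ) : GaussianInt) * (ε * β) := by
      calc β' * ((β.norm : ℤ) : GaussianInt) = β' * star β * β := by rw [hNb]; ring
        _ = (β.norm : ℤ) * ε * β := by rw [hε]
        _ = _ := by ring
    rw [mul_comm] at h1
    exact mul_left_cancel₀ hN0' h1
  refine ⟨ε, hnormε, hβ', ?_⟩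
  rw [hβ'] at hprod
  have h2 : β * (ε * γ' - γ) = 0 := by linear_combination hprod
  rcases mul_eq_zero.1 h2 with h3 | h3
  · exact absurd h3 hβ
  · have h4 : ε * γ' = γ := by linear_combination h3
    have hεε : star ε * ε = 1 := by
      have := Zsqrtd.norm_eq_mul_conj ε
      rw [hnormε] at this
      calc star ε * ε = ε * star ε := by ring
        _ = ((1 : ℤ) : GaussianInt) := this.symm
        _ = 1 := by simp
    calc γ' = (star ε * ε) * γ' := by rw [hεε, one_mul]
      _ = star ε * (ε * γ') := by ring
      _ = star ε * γ := by rw [h4]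

/-- Decoding the parameters from the Gaussian integers. [folklore] -/
def decode (q : GaussianInt × GaussianInt) : (ℤ × ℤ) × (ℤ × ℤ) :=
  (((q.1.re - 1) / 2, q.1.im / 2), ((q.2.re - 1) / 2, q.2.im / 2))

/-- `decode` inverts `(a, b) ↦ (gauss a, gauss b)`. [folklore] -/
theorem decode_gauss (p : (ℤ × ℤ) × (ℤ × ℤ)) : decode (gauss p.1, gauss p.2) = p := by
  obtain ⟨⟨a1, a2⟩, ⟨b1, b2⟩⟩ := p
  simp only [decode, gauss]
  congr 2 <;> omega

/-- Equal quadruples have equal products `βγ`. [folklore] -/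
theorem gauss_mul_gauss_eq_of_pyth_eq {p p' : (ℤ × ℤ) × (ℤ × ℤ)} (h : pyth p' = pyth p) :
    gauss p'.1 * gauss p'.2 = gauss p.1 * gauss p.2 := by
  ext
  · rw [← pyth_two_eq, ← pyth_two_eq, h]
  · rw [← pyth_three_eq, ← pyth_three_eq, h]

/-- Equal quadruples have equal norms `N(β)`, `N(γ)`. [folklore] -/
theorem nrm_eq_of_pyth_eq {p p' : (ℤ × ℤ) × (ℤ × ℤ)} (h : pyth p' = pyth p) :
    nrm p'.1 = nrm p.1 ∧ nrm p'.2 = nrm p.2 := by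
  constructor
  · rw [← pyth_one_sub_pyth_zero, ← pyth_one_sub_pyth_zero, h]
  · rw [← pyth_one_add_pyth_zero, ← pyth_one_add_pyth_zero, h]

/-- The fibres of `pyth` over parameters with coprime norms lie in a `4`-element set. [folklore] -/
theorem filter_pyth_eq_subset {T : ℕ} {p : (ℤ × ℤ) × (ℤ × ℤ)} (hp : p ∈ good T) :
    {p' ∈ good T | pyth p' = pyth p} ⊆
      units4.image (fun ε => decode (ε * gauss p.1, star ε * gauss p.2)) := by
  intro p' hp'
  rw [mem_filter] at hp'
  obtain ⟨-, h⟩ := hp'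
  simp only [good, mem_filter] at hp
  obtain ⟨-, hcop, -, -⟩ := hp
  have hcop' : IsCoprime (gauss p.1).norm (gauss p.2).norm := by
    rw [norm_gauss, norm_gauss]; exact Int.isCoprime_iff_gcd_eq_one.2 hcop
  obtain ⟨hN1, hN2⟩ := nrm_eq_of_pyth_eq h
  obtain ⟨ε, hε, h1, h2⟩ := exists_unit_of_mul_eq (gauss_ne_zero p.1) hcop'
    (by rw [norm_gauss, norm_gauss, hN1]) (by rw [norm_gauss, norm_gauss, hN2])
    (gauss_mul_gauss_eq_of_pyth_eq h)
  rw [mem_image]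
  refine ⟨ε, mem_units4_of_norm_eq_one hε, ?_⟩
  rw [← h1, ← h2, decode_gauss]

/-- The fibres of `pyth` over good parameters have at most `4` elements. [folklore] -/
theorem card_filter_pyth_eq_le {T : ℕ} {p : (ℤ × ℤ) × (ℤ × ℤ)} (hp : p ∈ good T) :
    #{p' ∈ good T | pyth p' = pyth p} ≤ 4 :=
  ((card_le_card (filter_pyth_eq_subset hp)).trans card_image_le).trans card_units4_le

/-- `#good(T) ≤ 4 · #pyth(good(T))`. [folklore] -/
theorem card_good_le_image_pyth (T : ℕ) : #(good T) ≤ 4 * #((good T).image pyth) := by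
  refine card_le_mul_card_image _ 4 fun x hx => ?_
  obtain ⟨p, hp, rfl⟩ := mem_image.1 hx
  exact card_filter_pyth_eq_le hp

/-- The sign vectors `{±1}⁴`. [folklore] -/
def signs : Finset (Fin 4 → ℤ) := Fintype.piFinset fun _ => ({1, -1} : Finset ℤ)

/-- `#{±1}⁴ ≤ 16`. [folklore] -/
theorem card_signs_le : #signs ≤ 16 := by
  simp [signs, Fintype.card_piFinset]

/-- `𝐱 ↦ 𝐳 = (x₁², -x₂², x₃², x₄²)` is at most `16`-to-`1`. [folklore] -/
theorem filter_zvec_eq_subset (S : Finset (Fin 4 → ℤ)) (x : Fin 4 → ℤ) :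
    {x' ∈ S | zvec x' = zvec x} ⊆ signs.image (fun s => fun i => s i * x i) := by
  intro x' hx'
  rw [mem_filter] at hx'
  obtain ⟨-, h⟩ := hx'
  have hsq : ∀ i, x' i ^ 2 = x i ^ 2 := by
    intro i
    have h' := congrFun h i
    fin_cases i <;> simpa [zvec] using h'
  rw [mem_image]
  refine ⟨fun i => if x' i = x i then 1 else -1, ?_, ?_⟩
  · simp only [signs, Fintype.mem_piFinset]
    intro i
    split_ifs <;> simp
  · funext i
    show (if x' i = x i then 1 else -1) * x i = x' i
    by_cases h2 : x' i = x i
    · rw [if_pos h2, h2, one_mul]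
    · rcases sq_eq_sq_iff_eq_or_eq_neg.1 (hsq i) with h1 | h1
      · exact absurd h1 h2
      · rw [if_neg h2, h1]; ring

/-- `#S ≤ 16 · #zvec(S)`. [folklore] -/
theorem card_le_image_zvec (S : Finset (Fin 4 → ℤ)) : #S ≤ 16 * #(S.image zvec) := by
  refine card_le_mul_card_image _ 16 fun z hz => ?_
  obtain ⟨x, -, rfl⟩ := mem_image.1 hz
  exact ((card_le_card (filter_zvec_eq_subset S x)).trans card_image_le).trans card_signs_le

/-- **The lower bound in terms of the good parameters**: `#good(T) ≤ 64 N(B)` once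
`16 (2T+1)⁴ ≤ B`. [cite: Shute2021, Theorem 1.1 (lower bound only)] -/
theorem card_good_le_mainCount {T B : ℕ} (hB : 4 * (2 * (2 * T + 1) ^ 2) ^ 2 ≤ B) :
    #(good T) ≤ 64 * mainCount B := by
  have h1 := card_good_le_image_pyth T
  have h2 := card_le_image_zvec ((good T).image pyth)
  have h3 : ((good T).image pyth).image zvec ⊆ mainSet B := by
    intro z hz
    obtain ⟨x, hx, rfl⟩ := mem_image.1 hz
    obtain ⟨p, hp, rfl⟩ := mem_image.1 hx
    exact zvec_pyth_mem_mainSet hB hp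
  have h4 := card_le_card h3
  rw [mainCount_eq_card_mainSet]
  omega


/-! ### Counting the good parameters: a first-order sieve -/

/-- The interval `[-T, T] ⊆ ℤ`. [folklore] -/
noncomputable def ival (T : ℕ) : Finset ℤ := Icc (-(T : ℤ)) T

/-- `#[-T, T] = 2T + 1`. [folklore] -/
theorem card_ival (T : ℕ) : #(ival T) = 2 * T + 1 := by
  simp only [ival, Int.card_Icc]; omega

/-- `pbox T = ([-T,T] × [-T,T]) × ([-T,T] × [-T,T])`. [folklore] -/
theorem pbox_eq (T : ℕ) : pbox T = (ival T ×ˢ ival T) ×ˢ (ival T ×ˢ ival T) := rfl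

/-- `#pbox(T) = (2T+1)⁴`. [folklore] -/
theorem card_pbox (T : ℕ) : #(pbox T) = (2 * T + 1) ^ 4 := by
  rw [pbox_eq, card_product, card_product, card_ival]; ring

/-- `t ∈ [-T, T]` unfolded. [folklore] -/
theorem abs_le_of_mem_ival {T : ℕ} {t : ℤ} (ht : t ∈ ival T) : -(T : ℤ) ≤ t ∧ t ≤ T := by
  simpa [ival] using ht

/-- Residue classes in `[-T, T]`: at most `(2T+1)/P + 1` elements. [folklore] -/
theorem card_ival_filter_modEq_le (T : ℕ) {P : ℕ} (hP : 0 < P) (v : ℤ) :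
    #{x ∈ ival T | x ≡ v [ZMOD P]} ≤ (2 * T + 1) / P + 1 := by
  have hP' : (0 : ℤ) < P := by exact_mod_cast hP
  have key : ∀ x ∈ {x ∈ ival T | x ≡ v [ZMOD P]},
      ((x + T) / P).toNat ∈ range ((2 * T + 1) / P + 1) := by
    intro x hx
    rw [mem_filter] at hx
    obtain ⟨h1, h2⟩ := abs_le_of_mem_ival hx.1
    rw [mem_range, Nat.lt_succ_iff]
    have h3 : (x + T) / P ≤ ((2 * T + 1 : ℕ) : ℤ) / (P : ℤ) :=
      Int.ediv_le_ediv hP' (by push_cast; omega)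
    have h4 : (((2 * T + 1) / P : ℕ) : ℤ) = ((2 * T + 1 : ℕ) : ℤ) / (P : ℤ) := by
      exact Int.natCast_div _ _
    have h5 : 0 ≤ (x + T) / P := Int.ediv_nonneg (by omega) hP'.le
    omega
  refine (card_le_card_of_injOn (fun x : ℤ => ((x + (T : ℤ)) / (P : ℤ)).toNat) key ?_).trans
    (by simp)
  intro x hx x' hx' hxx'
  simp only [coe_filter, Set.mem_setOf_eq] at hx hx'
  obtain ⟨h1, -⟩ := abs_le_of_mem_ival hx.1
  obtain ⟨h1', -⟩ := abs_le_of_mem_ival hx'.1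
  have h5 : 0 ≤ (x + T) / P := Int.ediv_nonneg (by omega) hP'.le
  have h5' : 0 ≤ (x' + T) / P := Int.ediv_nonneg (by omega) hP'.le
  have hq : (x + T) / P = (x' + T) / P := by
    have := congrArg (fun n : ℕ => (n : ℤ)) hxx'
    simpa [Int.toNat_of_nonneg h5, Int.toNat_of_nonneg h5'] using this
  have hr : (x + T) % P = (x' + T) % P := (hx.2.trans hx'.2.symm).add_right T
  have e1 := Int.mul_ediv_add_emod (x + T) P
  have e2 := Int.mul_ediv_add_emod (x' + T) P
  rw [hq, hr] at e1
  linarith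

/-- At most two square roots in `ℤ/P`. [folklore] -/
theorem card_filter_sq_eq_le_two {P : ℕ} [Fact P.Prime] (c : ZMod P) :
    #{r : ZMod P | r ^ 2 = c} ≤ 2 := by
  by_cases h : ∃ r₀ : ZMod P, r₀ ^ 2 = c
  · obtain ⟨r₀, hr₀⟩ := h
    have hsub : ({r : ZMod P | r ^ 2 = c} : Finset (ZMod P)) ⊆ {r₀, -r₀} := by
      intro r hr
      rw [mem_filter] at hr
      rw [mem_insert, mem_singleton]
      exact sq_eq_sq_iff_eq_or_eq_neg.1 (hr.2.trans hr₀.symm)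
    exact (card_le_card hsub).trans (card_insert_le _ _)
  · have : ({r : ZMod P | r ^ 2 = c} : Finset (ZMod P)) = ∅ := by
      rw [filter_eq_empty_iff]
      intro r _ hr
      exact h ⟨r, hr⟩
    rw [this]; simp

/-- At most two elements of a set of integers have a given square. [folklore] -/
theorem card_filter_sq_eq_le (S : Finset ℤ) (c : ℤ) : #{y ∈ S | y ^ 2 = c} ≤ 2 := by
  by_cases h : ∃ y₀ ∈ S, y₀ ^ 2 = c
  · obtain ⟨y₀, -, hy₀⟩ := h
    have hsub : {y ∈ S | y ^ 2 = c} ⊆ {y₀, -y₀} := by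
      intro y hy
      rw [mem_filter] at hy
      rw [mem_insert, mem_singleton]
      exact sq_eq_sq_iff_eq_or_eq_neg.1 (hy.2.trans hy₀.symm)
    exact (card_le_card hsub).trans (card_insert_le _ _)
  · have : {y ∈ S | y ^ 2 = c} = ∅ := by
      rw [filter_eq_empty_iff]
      intro y hy hy'
      exact h ⟨y, hy, hy'⟩
    rw [this]; simp

/-- For an odd prime `P` and any `s`, at most `2((2T+1)/P + 1)` values `x ∈ [-T, T]` have
`P ∣ (2x+1)² + s`. [folklore] -/
theorem card_ival_filter_dvd_sq_le (T : ℕ) {P : ℕ} (hP : P.Prime) (hP2 : P ≠ 2) (s : ℤ) :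
    #{x ∈ ival T | (P : ℤ) ∣ (2 * x + 1) ^ 2 + s} ≤ 2 * ((2 * T + 1) / P + 1) := by
  haveI := Fact.mk hP
  set f : ℤ → ZMod P := fun x => ((2 * x + 1 : ℤ) : ZMod P) with hf
  set t : Finset (ZMod P) := {r : ZMod P | r ^ 2 = -(s : ZMod P)} with ht
  have Hf : ∀ x ∈ {x ∈ ival T | (P : ℤ) ∣ (2 * x + 1) ^ 2 + s}, f x ∈ t := by
    intro x hx
    rw [mem_filter] at hx
    obtain ⟨-, hdvd⟩ := hx
    rw [ht, mem_filter]
    refine ⟨mem_univ _, ?_⟩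
    have h0 : (((2 * x + 1) ^ 2 + s : ℤ) : ZMod P) = 0 :=
      (ZMod.intCast_zmod_eq_zero_iff_dvd _ P).2 hdvd
    push_cast at h0
    rw [hf]; push_cast
    linear_combination h0
  have hfib : ∀ r ∈ t, #{x ∈ {x ∈ ival T | (P : ℤ) ∣ (2 * x + 1) ^ 2 + s} | f x = r} ≤
      (2 * T + 1) / P + 1 := by
    intro r _
    by_cases hne : ∃ x₀ ∈ {x ∈ ival T | (P : ℤ) ∣ (2 * x + 1) ^ 2 + s}, f x₀ = r
    · obtain ⟨x₀, -, hx₀⟩ := hne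
      refine (card_le_card ?_).trans (card_ival_filter_modEq_le T hP.pos x₀)
      intro x hx
      rw [mem_filter, mem_filter] at hx
      obtain ⟨⟨hxI, -⟩, hxr⟩ := hx
      rw [mem_filter]
      refine ⟨hxI, ?_⟩
      have h1 : ((2 * x + 1 : ℤ) : ZMod P) = ((2 * x₀ + 1 : ℤ) : ZMod P) := hxr.trans hx₀.symm
      rw [ZMod.intCast_eq_intCast_iff_dvd_sub] at h1
      have h2 : (P : ℤ) ∣ 2 * (x - x₀) := by
        have : (2 * x₀ + 1 : ℤ) - (2 * x + 1) = 2 * (x₀ - x) := by ring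
        rw [this] at h1
        have h3 : (P : ℤ) ∣ -(2 * (x₀ - x)) := (dvd_neg).2 h1
        have : -(2 * (x₀ - x)) = 2 * (x - x₀) := by ring
        rwa [this] at h3
      have hPp : Prime (P : ℤ) := Int.prime_iff_natAbs_prime.2 (by simpa using hP)
      rcases hPp.dvd_or_dvd h2 with h3 | h3
      · exfalso
        have h4 : P ∣ 2 := by exact_mod_cast Int.natCast_dvd_natCast.1 h3
        have := (Nat.prime_dvd_prime_iff_eq hP Nat.prime_two).1 h4
        exact hP2 this
      · exact (Int.modEq_iff_dvd.2 h3).symm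
    · have : {x ∈ {x ∈ ival T | (P : ℤ) ∣ (2 * x + 1) ^ 2 + s} | f x = r} = ∅ := by
        rw [filter_eq_empty_iff]
        intro x hx hxr
        exact hne ⟨x, hx, hxr⟩
      rw [this]; simp
  calc #{x ∈ ival T | (P : ℤ) ∣ (2 * x + 1) ^ 2 + s}
      ≤ ((2 * T + 1) / P + 1) * #t := card_le_mul_card_image_of_maps_to Hf _ hfib
    _ ≤ ((2 * T + 1) / P + 1) * 2 :=
        Nat.mul_le_mul_left _ (card_filter_sq_eq_le_two _)
    _ = 2 * ((2 * T + 1) / P + 1) := by ring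

/-- Parameter pairs in `[-T, T]²` whose norm is divisible by `P`. [folklore] -/
noncomputable def normDiv (T P : ℕ) : Finset (ℤ × ℤ) :=
  {a ∈ ival T ×ˢ ival T | (P : ℤ) ∣ nrm a}

/-- For an odd prime `P`, `#{a ∈ [-T,T]² : P ∣ N(gauss a)} ≤ (2T+1) · 2((2T+1)/P + 1)`. [folklore] -/
theorem card_normDiv_le (T : ℕ) {P : ℕ} (hP : P.Prime) (hP2 : P ≠ 2) :
    #(normDiv T P) ≤ (2 * T + 1) * (2 * ((2 * T + 1) / P + 1)) := by
  calc #(normDiv T P)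
      = ∑ a2 ∈ ival T, #{x ∈ ival T | (P : ℤ) ∣ (2 * x + 1) ^ 2 + (2 * a2) ^ 2} := by
        unfold normDiv nrm
        rw [card_filter, sum_product_right]
        refine sum_congr rfl fun a2 _ => ?_
        rw [card_filter]
    _ ≤ ∑ _a2 ∈ ival T, 2 * ((2 * T + 1) / P + 1) :=
        sum_le_sum fun a2 _ => card_ival_filter_dvd_sq_le T hP hP2 _
    _ = (2 * T + 1) * (2 * ((2 * T + 1) / P + 1)) := by
        rw [sum_const, card_ival, smul_eq_mul]

/-- `a² + b² = 0` in `ℤ/3` forces `a = b = 0`. [folklore] -/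
theorem sq_add_sq_zmod_three (a b : ZMod 3) (h : a ^ 2 + b ^ 2 = 0) : a = 0 ∧ b = 0 := by
  revert a b h; decide

/-- `#{a ∈ [-T,T]² : 3 ∣ N(gauss a)} ≤ ((2T+1)/3 + 1)²` (`3 ∣ s² + t² ⟹ 3 ∣ s, t`). [folklore] -/
theorem card_normDiv_three_le (T : ℕ) :
    #(normDiv T 3) ≤ ((2 * T + 1) / 3 + 1) ^ 2 := by
  have hsub : normDiv T 3 ⊆
      {x ∈ ival T | x ≡ 1 [ZMOD (3 : ℕ)]} ×ˢ {y ∈ ival T | y ≡ 0 [ZMOD (3 : ℕ)]} := by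
    intro a ha
    simp only [normDiv, nrm, mem_filter, mem_product] at ha
    obtain ⟨⟨h1, h2⟩, hdvd⟩ := ha
    have h0 : ((((2 * a.1 + 1) ^ 2 + (2 * a.2) ^ 2 : ℤ)) : ZMod 3) = 0 :=
      (ZMod.intCast_zmod_eq_zero_iff_dvd _ 3).2 (by exact_mod_cast hdvd)
    push_cast at h0
    obtain ⟨h3, h4⟩ := sq_add_sq_zmod_three _ _ h0
    have h3' : ((3 : ℕ) : ℤ) ∣ 2 * a.1 + 1 := by
      have := (ZMod.intCast_zmod_eq_zero_iff_dvd (2 * a.1 + 1) 3).1 (by push_cast; exact h3)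
      exact_mod_cast this
    have h4' : ((3 : ℕ) : ℤ) ∣ 2 * a.2 := by
      have := (ZMod.intCast_zmod_eq_zero_iff_dvd (2 * a.2) 3).1 (by push_cast; exact h4)
      exact_mod_cast this
    rw [mem_product, mem_filter, mem_filter]
    refine ⟨⟨h1, ?_⟩, ⟨h2, ?_⟩⟩
    · rw [Int.ModEq]; push_cast at h3' ⊢; omega
    · rw [Int.ModEq]; push_cast at h4' ⊢; omega
  refine (card_le_card hsub).trans ?_
  rw [card_product, sq]
  exact Nat.mul_le_mul (card_ival_filter_modEq_le T (by norm_num) 1)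
    (card_ival_filter_modEq_le T (by norm_num) 0)

/-- The norm of a parameter pair in the box is at most `2 (2T+1)²`. [folklore] -/
theorem nrm_le_of_mem {T : ℕ} {a : ℤ × ℤ} (ha : a ∈ ival T ×ˢ ival T) :
    nrm a ≤ 2 * (2 * T + 1) ^ 2 := by
  rw [mem_product] at ha
  obtain ⟨h1, h2⟩ := abs_le_of_mem_ival ha.1
  obtain ⟨h3, h4⟩ := abs_le_of_mem_ival ha.2
  unfold nrm
  nlinarith

/-- Two primes `> 2(2T+1)` dividing the norm of a pair in the box coincide. [folklore] -/
theorem prime_unique {T : ℕ} {a : ℤ × ℤ} (ha : a ∈ ival T ×ˢ ival T) {P P' : ℕ}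
    (hP : P.Prime) (hP' : P'.Prime) (hPl : 2 * (2 * T + 1) < P) (hP'l : 2 * (2 * T + 1) < P')
    (hdP : (P : ℤ) ∣ nrm a) (hdP' : (P' : ℤ) ∣ nrm a) : P = P' := by
  by_contra hne
  have hcop : Nat.Coprime P P' := (Nat.coprime_primes hP hP').2 hne
  have h1 : P ∣ (nrm a).natAbs := Int.natCast_dvd.1 hdP
  have h2 : P' ∣ (nrm a).natAbs := Int.natCast_dvd.1 hdP'
  have h3 : P * P' ∣ (nrm a).natAbs := hcop.mul_dvd_of_dvd_of_dvd h1 h2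
  have hpos := nrm_pos a
  have h4 : P * P' ≤ (nrm a).natAbs := Nat.le_of_dvd (Int.natAbs_pos.2 hpos.ne') h3
  have h5 : ((nrm a).natAbs : ℤ) = nrm a := Int.natAbs_of_nonneg hpos.le
  have h6 := nrm_le_of_mem ha
  have h7 : (P : ℤ) * P' ≤ 2 * (2 * T + 1) ^ 2 := by
    have : ((P * P' : ℕ) : ℤ) ≤ nrm a := by rw [← h5]; exact_mod_cast h4
    push_cast at this; linarith
  have h8 : (2 * (2 * (T : ℤ) + 1)) * (2 * (2 * T + 1)) < (P : ℤ) * P' := by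
    have hPl' : 2 * (2 * (T : ℤ) + 1) < P := by exact_mod_cast hPl
    have hP'l' : 2 * (2 * (T : ℤ) + 1) < P' := by exact_mod_cast hP'l
    exact mul_lt_mul'' hPl' hP'l' (by positivity) (by positivity)
  nlinarith

open Classical in
/-- Pairs of parameter pairs whose norms share a prime factor `> 2(2T+1)`. [folklore] -/
noncomputable def largeBad (T : ℕ) : Finset ((ℤ × ℤ) × (ℤ × ℤ)) :=
  {p ∈ pbox T | ∃ P : ℕ, P.Prime ∧ 2 * (2 * T + 1) < P ∧ (P : ℤ) ∣ nrm p.1 ∧ (P : ℤ) ∣ nrm p.2}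

/-- At most `2(2T+1)³` parameters have norms sharing a prime factor `> 2(2T+1)`. [folklore] -/
theorem card_largeBad_le (T : ℕ) : #(largeBad T) ≤ (2 * T + 1) ^ 2 * (2 * (2 * T + 1)) := by
  classical
  have hW : #(ival T ×ˢ ival T) = (2 * T + 1) ^ 2 := by rw [card_product, card_ival]; ring
  calc #(largeBad T)
      = ∑ a ∈ ival T ×ˢ ival T, #{b ∈ ival T ×ˢ ival T | ∃ P : ℕ, P.Prime ∧
          2 * (2 * T + 1) < P ∧ (P : ℤ) ∣ nrm a ∧ (P : ℤ) ∣ nrm b} := by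
        unfold largeBad
        rw [pbox_eq, card_filter, sum_product]
        refine sum_congr rfl fun a _ => ?_
        rw [card_filter]
    _ ≤ ∑ _a ∈ ival T ×ˢ ival T, 2 * (2 * T + 1) := by
        refine sum_le_sum fun a ha => ?_
        by_cases hex : ∃ P : ℕ, P.Prime ∧ 2 * (2 * T + 1) < P ∧ (P : ℤ) ∣ nrm a
        · obtain ⟨P₀, hP₀, hP₀l, hP₀d⟩ := hex
          have hP₀2 : P₀ ≠ 2 := by omega
          have hsub : {b ∈ ival T ×ˢ ival T | ∃ P : ℕ, P.Prime ∧
              2 * (2 * T + 1) < P ∧ (P : ℤ) ∣ nrm a ∧ (P : ℤ) ∣ nrm b} ⊆ normDiv T P₀ := by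
            intro b hb
            rw [mem_filter] at hb
            obtain ⟨hbI, P, hP, hPl, hPa, hPb⟩ := hb
            have := prime_unique ha hP hP₀ hPl hP₀l hPa hP₀d
            subst this
            exact mem_filter.2 ⟨hbI, hPb⟩
          refine (card_le_card hsub).trans ((card_normDiv_le T hP₀ hP₀2).trans ?_)
          rw [Nat.div_eq_of_lt (by omega)]
          omega
        · have : {b ∈ ival T ×ˢ ival T | ∃ P : ℕ, P.Prime ∧
              2 * (2 * T + 1) < P ∧ (P : ℤ) ∣ nrm a ∧ (P : ℤ) ∣ nrm b} = ∅ := by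
            rw [filter_eq_empty_iff]
            rintro b - ⟨P, hP, hPl, hPa, -⟩
            exact hex ⟨P, hP, hPl, hPa⟩
          rw [this]; simp
    _ = (2 * T + 1) ^ 2 * (2 * (2 * T + 1)) := by rw [sum_const, hW, smul_eq_mul]

/-- The parameters with `x₁ = 0`, i.e. `N(β) = N(γ)`. [folklore] -/
noncomputable def vanish0 (T : ℕ) : Finset ((ℤ × ℤ) × (ℤ × ℤ)) := {p ∈ pbox T | pyth p 0 = 0}

/-- At most `2(2T+1)³` parameters have `x₁ = 0`. [folklore] -/
theorem card_vanish0_le (T : ℕ) : #(vanish0 T) ≤ (2 * T + 1) ^ 2 * ((2 * T + 1) * 2) := by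
  have hW : #(ival T ×ˢ ival T) = (2 * T + 1) ^ 2 := by rw [card_product, card_ival]; ring
  calc #(vanish0 T)
      = ∑ a ∈ ival T ×ˢ ival T, ∑ b1 ∈ ival T, #{b2 ∈ ival T | pyth (a, (b1, b2)) 0 = 0} := by
        unfold vanish0
        rw [pbox_eq, card_filter, sum_product]
        refine sum_congr rfl fun a _ => ?_
        rw [sum_product]
        refine sum_congr rfl fun b1 _ => ?_
        rw [card_filter]
    _ ≤ ∑ _a ∈ ival T ×ˢ ival T, ∑ _b1 ∈ ival T, 2 := by
        refine sum_le_sum fun a _ => sum_le_sum fun b1 _ => ?_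
        refine (card_le_card ?_).trans
          (card_filter_sq_eq_le (ival T) (a.1 ^ 2 + a.1 + a.2 ^ 2 - b1 ^ 2 - b1))
        intro b2 hb2
        rw [mem_filter] at hb2 ⊢
        refine ⟨hb2.1, ?_⟩
        have h := hb2.2
        simp only [pyth, Fin.isValue, Matrix.cons_val_zero] at h
        linarith
    _ = (2 * T + 1) ^ 2 * ((2 * T + 1) * 2) := by
        rw [sum_const, sum_const, card_ival, hW, smul_eq_mul, smul_eq_mul]

/-- The parameters with `x₄ = 0`. [folklore] -/
noncomputable def vanish3 (T : ℕ) : Finset ((ℤ × ℤ) × (ℤ × ℤ)) := {p ∈ pbox T | pyth p 3 = 0}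

/-- At most `(2T+1)³` parameters have `x₄ = 0`. [folklore] -/
theorem card_vanish3_le (T : ℕ) : #(vanish3 T) ≤ (2 * T + 1) ^ 2 * ((2 * T + 1) * 1) := by
  have hW : #(ival T ×ˢ ival T) = (2 * T + 1) ^ 2 := by rw [card_product, card_ival]; ring
  calc #(vanish3 T)
      = ∑ a ∈ ival T ×ˢ ival T, ∑ b1 ∈ ival T, #{b2 ∈ ival T | pyth (a, (b1, b2)) 3 = 0} := by
        unfold vanish3
        rw [pbox_eq, card_filter, sum_product]
        refine sum_congr rfl fun a _ => ?_
        rw [sum_product]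
        refine sum_congr rfl fun b1 _ => ?_
        rw [card_filter]
    _ ≤ ∑ _a ∈ ival T ×ˢ ival T, ∑ _b1 ∈ ival T, 1 := by
        refine sum_le_sum fun a _ => sum_le_sum fun b1 _ => ?_
        rw [card_le_one]
        intro b2 hb2 b2' hb2'
        rw [mem_filter] at hb2 hb2'
        have h := hb2.2
        have h' := hb2'.2
        simp only [pyth, Fin.isValue, Matrix.cons_val] at h h'
        have h0 : (2 * a.1 + 1) * (2 * (b2 - b2')) = 0 := by linarith
        rcases mul_eq_zero.1 h0 with h1 | h1
        · omega
        · omega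
    _ = (2 * T + 1) ^ 2 * ((2 * T + 1) * 1) := by
        rw [sum_const, sum_const, card_ival, hW, smul_eq_mul, smul_eq_mul]

/-- The primes `5 ≤ P ≤ 2(2T+1)`. [folklore] -/
def primes5 (T : ℕ) : Finset ℕ := {P ∈ Icc 5 (2 * (2 * T + 1)) | P.Prime}

/-- `#primes5(T) ≤ 2(2T+1)`. [folklore] -/
theorem card_primes5_le (T : ℕ) : #(primes5 T) ≤ 2 * (2 * T + 1) := by
  refine (card_filter_le _ _).trans ?_
  simp

/-- The norms are odd. [folklore] -/
theorem not_two_dvd_nrm (a : ℤ × ℤ) : ¬ (2 : ℤ) ∣ nrm a := by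
  unfold nrm
  intro h
  have : (2 * a.1 + 1) ^ 2 + (2 * a.2) ^ 2 = 2 * (2 * a.1 ^ 2 + 2 * a.1 + 2 * a.2 ^ 2) + 1 := by
    ring
  rw [this] at h
  omega

/-- **The sieve decomposition**: a parameter in the box is good, or has `x₁ = 0`, or `x₄ = 0`,
or both norms are divisible by `3`, by a prime `5 ≤ P ≤ 2(2T+1)`, or by a prime `> 2(2T+1)`.
[folklore] -/
theorem pbox_subset (T : ℕ) :
    pbox T ⊆ good T ∪ vanish0 T ∪ vanish3 T ∪ normDiv T 3 ×ˢ normDiv T 3 ∪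
      (primes5 T).biUnion (fun P => normDiv T P ×ˢ normDiv T P) ∪ largeBad T := by
  classical
  intro p hp
  simp only [mem_union]
  by_cases h0 : pyth p 0 = 0
  · exact Or.inl (Or.inl (Or.inl (Or.inl (Or.inr (by unfold vanish0; exact mem_filter.2 ⟨hp, h0⟩)))))
  by_cases h3 : pyth p 3 = 0
  · exact Or.inl (Or.inl (Or.inl (Or.inr (by unfold vanish3; exact mem_filter.2 ⟨hp, h3⟩))))
  by_cases hg : Int.gcd (nrm p.1) (nrm p.2) = 1
  · exact Or.inl (Or.inl (Or.inl (Or.inl (Or.inl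
      (by unfold good; exact mem_filter.2 ⟨hp, hg, h0, h3⟩)))))
  -- a prime factor of the gcd
  have hp12 : p.1 ∈ ival T ×ˢ ival T ∧ p.2 ∈ ival T ×ˢ ival T := by
    rw [pbox_eq, mem_product] at hp; exact hp
  set P := (Int.gcd (nrm p.1) (nrm p.2)).minFac with hPdef
  have hPp : P.Prime := Nat.minFac_prime hg
  have hPg : P ∣ Int.gcd (nrm p.1) (nrm p.2) := Nat.minFac_dvd _
  have hP1 : (P : ℤ) ∣ nrm p.1 :=
    (Int.natCast_dvd_natCast.2 hPg).trans (Int.gcd_dvd_left _ _)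
  have hP2 : (P : ℤ) ∣ nrm p.2 :=
    (Int.natCast_dvd_natCast.2 hPg).trans (Int.gcd_dvd_right _ _)
  have hPne2 : P ≠ 2 := by
    intro h2
    rw [h2] at hP1
    exact not_two_dvd_nrm p.1 (by exact_mod_cast hP1)
  have hPne4 : P ≠ 4 := by
    intro h4; rw [h4] at hPp; exact absurd hPp (by decide)
  have hP2le := hPp.two_le
  have hmem : ∀ Q : ℕ, (Q : ℤ) ∣ nrm p.1 → (Q : ℤ) ∣ nrm p.2 →
      p ∈ normDiv T Q ×ˢ normDiv T Q := fun Q h1 h2 => by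
    unfold normDiv
    exact mem_product.2 ⟨mem_filter.2 ⟨hp12.1, h1⟩, mem_filter.2 ⟨hp12.2, h2⟩⟩
  rcases Nat.lt_or_ge (2 * (2 * T + 1)) P with hl | hl
  · refine Or.inr ?_
    unfold largeBad
    exact mem_filter.2 ⟨hp, P, hPp, hl, hP1, hP2⟩
  rcases Nat.lt_or_ge P 5 with hs | hs
  · have hP3 : P = 3 := by omega
    refine Or.inl (Or.inl (Or.inr ?_))
    rw [← hP3]; exact hmem P hP1 hP2
  · refine Or.inl (Or.inr ?_)
    rw [mem_biUnion]
    exact ⟨P, mem_filter.2 ⟨mem_Icc.2 ⟨hs, hl⟩, hPp⟩, hmem P hP1 hP2⟩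

/-- **The sieve bound in `ℕ`**: `(2T+1)⁴ ≤ #good + #bad` with the bad set bounded piecewise. [folklore] -/
theorem card_pbox_le (T : ℕ) :
    (2 * T + 1) ^ 4 ≤ #(good T) + (2 * T + 1) ^ 2 * ((2 * T + 1) * 2) +
      (2 * T + 1) ^ 2 * ((2 * T + 1) * 1) + (((2 * T + 1) / 3 + 1) ^ 2) ^ 2 +
      ∑ P ∈ primes5 T, ((2 * T + 1) * (2 * ((2 * T + 1) / P + 1))) ^ 2 +
      (2 * T + 1) ^ 2 * (2 * (2 * T + 1)) := by
  have h := card_le_card (pbox_subset T)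
  rw [card_pbox] at h
  refine h.trans ?_
  refine (card_union_le _ _).trans (Nat.add_le_add ?_ (card_largeBad_le T))
  refine (card_union_le _ _).trans (Nat.add_le_add ?_ ?_)
  · refine (card_union_le _ _).trans (Nat.add_le_add ?_ ?_)
    · refine (card_union_le _ _).trans (Nat.add_le_add ?_ (card_vanish3_le T))
      exact (card_union_le _ _).trans (Nat.add_le_add le_rfl (card_vanish0_le T))
    · rw [card_product, ← sq]
      exact Nat.pow_le_pow_left (card_normDiv_three_le T) 2
  · refine card_biUnion_le.trans (sum_le_sum fun P hP => ?_)
    have hP' := (mem_filter.1 hP)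
    have hP5 : 5 ≤ P := (mem_Icc.1 hP'.1).1
    rw [card_product, ← sq]
    exact Nat.pow_le_pow_left (card_normDiv_le T hP'.2 (by omega)) 2


/-! ### The numerical sieve bound -/

/-- `∑_{5 ≤ P ≤ 2(2T+1), P prime} 1/P² ≤ 1/8` (compare with `∑_{k ≥ 0} 1/(4(k+2)(k+3)) = 1/8`).
[folklore] -/
theorem sum_primes5_inv_sq_le (T : ℕ) : ∑ P ∈ primes5 T, (1 : ℝ) / (P : ℝ) ^ 2 ≤ 1 / 8 := by
  set g : ℕ → ℝ := fun k => (1 / 4 : ℝ) * (1 / ((k : ℝ) + 2) - 1 / ((k : ℝ) + 3)) with hg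
  set φ : ℕ → ℕ := fun P => (P - 5) / 2 with hφ
  have hodd : ∀ P ∈ primes5 T, P = 2 * φ P + 5 := by
    intro P hP
    simp only [primes5, mem_filter, mem_Icc] at hP
    obtain ⟨⟨h5, -⟩, hp⟩ := hP
    rcases hp.eq_two_or_odd with h2 | h2
    · omega
    · show P = 2 * ((P - 5) / 2) + 5
      omega
  have hinj : Set.InjOn φ (primes5 T) := by
    intro P hP P' hP' h
    rw [hodd P hP, hodd P' hP', h]
  have hterm : ∀ P ∈ primes5 T, (1 : ℝ) / (P : ℝ) ^ 2 ≤ g (φ P) := by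
    intro P hP
    have hPk : (P : ℝ) = 2 * (φ P : ℝ) + 5 := by exact_mod_cast hodd P hP
    rw [hg, hPk]
    simp only
    have hk : (0 : ℝ) ≤ φ P := Nat.cast_nonneg _
    have e : (1 / 4 : ℝ) * (1 / ((φ P : ℝ) + 2) - 1 / ((φ P : ℝ) + 3)) =
        1 / (4 * ((φ P : ℝ) + 2) * ((φ P : ℝ) + 3)) := by
      field_simp; ring
    rw [e]
    exact one_div_le_one_div_of_le (by positivity) (by nlinarith)
  have himg : (primes5 T).image φ ⊆ range (2 * T + 1) := by
    intro k hk
    obtain ⟨P, hP, rfl⟩ := mem_image.1 hk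
    have hP' := hP
    simp only [primes5, mem_filter, mem_Icc] at hP'
    rw [mem_range]
    show (P - 5) / 2 < 2 * T + 1
    omega
  have hgnn : ∀ k ∈ range (2 * T + 1), 0 ≤ g k := by
    intro k _
    rw [hg]; simp only
    have : (1 : ℝ) / ((k : ℝ) + 3) ≤ 1 / ((k : ℝ) + 2) :=
      one_div_le_one_div_of_le (by positivity) (by linarith)
    linarith
  calc ∑ P ∈ primes5 T, (1 : ℝ) / (P : ℝ) ^ 2
      ≤ ∑ P ∈ primes5 T, g (φ P) := sum_le_sum hterm
    _ = ∑ k ∈ (primes5 T).image φ, g k := (sum_image hinj).symm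
    _ ≤ ∑ k ∈ range (2 * T + 1), g k := sum_le_sum_of_subset_of_nonneg himg fun k hk _ => hgnn k hk
    _ = (1 / 4 : ℝ) * (1 / 2 - 1 / ((2 * T + 1 : ℕ) + 2)) := by
        rw [hg, ← mul_sum]
        have hs : ∑ i ∈ range (2 * T + 1), ((1 : ℝ) / ((i : ℝ) + 2) - 1 / ((i : ℝ) + 3)) =
            ∑ i ∈ range (2 * T + 1),
              ((fun k : ℕ => (1 : ℝ) / ((k : ℝ) + 2)) i -
                (fun k : ℕ => (1 : ℝ) / ((k : ℝ) + 2)) (i + 1)) := by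
          refine sum_congr rfl fun i _ => ?_
          simp only [Nat.cast_add, Nat.cast_one]
          ring
        rw [hs, Finset.sum_range_sub']
        norm_num
    _ ≤ 1 / 8 := by
        have : (0 : ℝ) ≤ 1 / ((2 * T + 1 : ℕ) + 2) := by positivity
        linarith

/-- **The good parameters have positive density**: `(2T+1)⁴ ≤ 4 · #good(T)` for `T ≥ 360`.
[folklore] -/
theorem pow_four_le_card_good {T : ℕ} (hT : 360 ≤ T) : (2 * T + 1) ^ 4 ≤ 4 * #(good T) := by
  have h := card_pbox_le T
  set W : ℕ := 2 * T + 1 with hW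
  have hT' : (360 : ℝ) ≤ T := by exact_mod_cast hT
  have hW6 : (720 : ℝ) ≤ W := by rw [hW]; push_cast; linarith
  have hw0 : (0 : ℝ) ≤ W := by linarith
  -- the terms of the sieve bound, in `ℝ`
  have h3 : (((W / 3 + 1) ^ 2) ^ 2 : ℕ) ≤ (W : ℝ) ^ 4 / 16 := by
    have h1 : ((W / 3 : ℕ) : ℝ) ≤ (W : ℝ) / 3 := Nat.cast_div_le
    have h2 : ((W / 3 : ℕ) : ℝ) + 1 ≤ (W : ℝ) / 2 := by linarith
    have h0 : (0 : ℝ) ≤ ((W / 3 : ℕ) : ℝ) + 1 := by positivity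
    have h4 : (((W / 3 : ℕ) : ℝ) + 1) ^ 4 ≤ ((W : ℝ) / 2) ^ 4 := pow_le_pow_left₀ h0 h2 4
    push_cast
    nlinarith [h4]
  have hPbound : ∀ P ∈ primes5 T, (((W * (2 * (W / P + 1))) ^ 2 : ℕ) : ℝ) ≤
      5 * (W : ℝ) ^ 4 * (1 / (P : ℝ) ^ 2) + 20 * (W : ℝ) ^ 2 := by
    intro P hP
    have hP5 : (5 : ℝ) ≤ P := by
      have := (mem_Icc.1 (mem_filter.1 hP).1).1; exact_mod_cast this
    have hP0 : (0 : ℝ) < P := by linarith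
    have h1 : ((W / P : ℕ) : ℝ) ≤ (W : ℝ) / P := Nat.cast_div_le
    set x : ℝ := (W : ℝ) / P with hx
    have hx0 : 0 ≤ x := by positivity
    have h2 : (((W / P : ℕ) : ℝ) + 1) ^ 2 ≤ (x + 1) ^ 2 :=
      pow_le_pow_left₀ (by positivity) (by linarith) 2
    have h3 : (x + 1) ^ 2 ≤ 5 / 4 * x ^ 2 + 5 := by nlinarith [sq_nonneg (x / 2 - 2)]
    have h4 : x ^ 2 = (W : ℝ) ^ 2 * (1 / (P : ℝ) ^ 2) := by rw [hx]; field_simp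
    push_cast
    nlinarith [h2, h3, h4, sq_nonneg (W : ℝ)]
  have hsum : ((∑ P ∈ primes5 T, (W * (2 * (W / P + 1))) ^ 2 : ℕ) : ℝ) ≤
      5 / 8 * (W : ℝ) ^ 4 + 40 * (W : ℝ) ^ 3 := by
    push_cast [Nat.cast_sum]
    calc ∑ P ∈ primes5 T, (((W : ℝ) * (2 * (((W / P : ℕ) : ℝ) + 1))) ^ 2)
        ≤ ∑ P ∈ primes5 T, (5 * (W : ℝ) ^ 4 * (1 / (P : ℝ) ^ 2) + 20 * (W : ℝ) ^ 2) := by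
          refine sum_le_sum fun P hP => ?_
          have := hPbound P hP
          push_cast at this
          exact this
      _ = 5 * (W : ℝ) ^ 4 * ∑ P ∈ primes5 T, 1 / (P : ℝ) ^ 2 +
            20 * (W : ℝ) ^ 2 * #(primes5 T) := by
          rw [sum_add_distrib, ← mul_sum, sum_const, nsmul_eq_mul]; ring
      _ ≤ 5 * (W : ℝ) ^ 4 * (1 / 8) + 20 * (W : ℝ) ^ 2 * (2 * W) := by
          have h1 := sum_primes5_inv_sq_le T
          have h2 : (#(primes5 T) : ℝ) ≤ 2 * W := by exact_mod_cast card_primes5_le T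
          have h3 : (0 : ℝ) ≤ 5 * (W : ℝ) ^ 4 := by positivity
          have h4 : (0 : ℝ) ≤ 20 * (W : ℝ) ^ 2 := by positivity
          nlinarith
      _ = 5 / 8 * (W : ℝ) ^ 4 + 40 * (W : ℝ) ^ 3 := by ring
  -- assemble
  have hcast : ((W ^ 4 : ℕ) : ℝ) ≤ #(good T) + (W : ℝ) ^ 2 * (W * 2) + (W : ℝ) ^ 2 * (W * 1) +
      (W : ℝ) ^ 4 / 16 + (5 / 8 * (W : ℝ) ^ 4 + 40 * (W : ℝ) ^ 3) + (W : ℝ) ^ 2 * (2 * W) := by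
    have h' : ((W ^ 4 : ℕ) : ℝ) ≤ ((#(good T) + W ^ 2 * (W * 2) + W ^ 2 * (W * 1) +
        ((W / 3 + 1) ^ 2) ^ 2 + ∑ P ∈ primes5 T, (W * (2 * (W / P + 1))) ^ 2 +
        W ^ 2 * (2 * W) : ℕ) : ℝ) := by exact_mod_cast h
    have e : ((#(good T) + W ^ 2 * (W * 2) + W ^ 2 * (W * 1) +
        ((W / 3 + 1) ^ 2) ^ 2 + ∑ P ∈ primes5 T, (W * (2 * (W / P + 1))) ^ 2 +
        W ^ 2 * (2 * W) : ℕ) : ℝ) = #(good T) + (W : ℝ) ^ 2 * (W * 2) + (W : ℝ) ^ 2 * (W * 1) +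
        (((W / 3 + 1) ^ 2) ^ 2 : ℕ) + ((∑ P ∈ primes5 T, (W * (2 * (W / P + 1))) ^ 2 : ℕ) : ℝ) +
        (W : ℝ) ^ 2 * (2 * W) := by push_cast; ring
    rw [e] at h'
    linarith [h3, hsum]
  have hfin : ((W ^ 4 : ℕ) : ℝ) ≤ 4 * #(good T) := by
    push_cast at hcast ⊢
    nlinarith [hcast, hW6, pow_nonneg hw0 3]
  exact_mod_cast hfin

/-! ### The lower bound for `N(B)` -/

/-- **`N(B) ≫ B`**: for `B ≥ 16 · 722⁴ + 16`, `B ≤ 2¹⁶ N(B)`. This is the lower bound of the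
order of magnitude asserted by Theorem 1.1 of the source, obtained here directly from the
sub-family `𝐲 = (1, -1, 1, 1)` of (1.5) (Pythagorean quadruples) — not the paper's route to
`c > 0` (Lemma 5.5, local densities). [cite: Shute2021, Theorem 1.1 (lower bound only)] -/
theorem le_mainCount {B : ℕ} (hB : 16 * 722 ^ 4 + 16 ≤ B) : B ≤ 2 ^ 16 * mainCount B := by
  set S := Nat.sqrt (B / 16) with hS
  set R := Nat.sqrt S with hR
  set T := (R - 1) / 2 with hT
  have hS1 : S ^ 2 ≤ B / 16 := Nat.sqrt_le' _
  have hS2 : B / 16 < (S + 1) ^ 2 := Nat.lt_succ_sqrt' _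
  have hR1 : R ^ 2 ≤ S := Nat.sqrt_le' _
  have hR2 : S < (R + 1) ^ 2 := Nat.lt_succ_sqrt' _
  have hR722 : 722 ≤ R := by
    rw [hR, Nat.le_sqrt]
    rw [hS, Nat.le_sqrt]
    omega
  have hT360 : 360 ≤ T := by omega
  have hW1 : 2 * T + 1 ≤ R := by omega
  have hW2 : R ≤ 2 * T + 2 := by omega
  -- `16 W⁴ ≤ B`
  have h16 : 4 * (2 * (2 * T + 1) ^ 2) ^ 2 ≤ B := by
    have h1 : (2 * T + 1) ^ 2 ≤ R ^ 2 := Nat.pow_le_pow_left hW1 2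
    have h2 : ((2 * T + 1) ^ 2) ^ 2 ≤ S ^ 2 := Nat.pow_le_pow_left (h1.trans hR1) 2
    have h3 : 4 * (2 * (2 * T + 1) ^ 2) ^ 2 = 16 * ((2 * T + 1) ^ 2) ^ 2 := by ring
    omega
  -- `B ≤ 256 W⁴`
  have h256 : B ≤ 256 * (2 * T + 1) ^ 4 := by
    have h1 : S + 1 ≤ (R + 1) ^ 2 := hR2
    have h2 : (S + 1) ^ 2 ≤ ((R + 1) ^ 2) ^ 2 := Nat.pow_le_pow_left h1 2
    have h3 : R + 1 ≤ 2 * (2 * T + 1) := by omega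
    have h4 : ((R + 1) ^ 2) ^ 2 ≤ ((2 * (2 * T + 1)) ^ 2) ^ 2 :=
      Nat.pow_le_pow_left (Nat.pow_le_pow_left h3 2) 2
    have h5 : ((2 * (2 * T + 1)) ^ 2) ^ 2 = 16 * (2 * T + 1) ^ 4 := by ring
    omega
  have hgood := pow_four_le_card_good hT360
  have hmain := card_good_le_mainCount h16
  calc B ≤ 256 * (2 * T + 1) ^ 4 := h256
    _ ≤ 256 * (4 * #(good T)) := Nat.mul_le_mul_left _ hgood
    _ ≤ 256 * (4 * (64 * mainCount B)) := Nat.mul_le_mul_left _ (Nat.mul_le_mul_left _ hmain)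
    _ = 2 ^ 16 * mainCount B := by ring

/-- **`N(B) ≫ B`, real form**: there are `c₀ > 0` and `B₀` with `c₀ B ≤ N(B)` for `B ≥ B₀`.
[cite: Shute2021, Theorem 1.1 (lower bound only)] -/
theorem exists_linear_le_mainCount :
    ∃ c₀ : ℝ, 0 < c₀ ∧ ∃ B₀ : ℕ, ∀ B : ℕ, B₀ ≤ B → c₀ * B ≤ mainCount B := by
  refine ⟨1 / 2 ^ 16, by positivity, 16 * 722 ^ 4 + 16, fun B hB => ?_⟩
  have h := le_mainCount hB
  have h' : (B : ℝ) ≤ 2 ^ 16 * (mainCount B : ℝ) := by exact_mod_cast h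
  rw [one_div_mul_eq_div, div_le_iff₀ (by positivity)]
  linarith


/-! ### Positivity of the leading constant -/

/-- If `|N(B) - cB| ≤ C B^θ` for all `B ≥ 1` with some `θ < 1`, then `c > 0`: the lower bound
`N(B) ≫ B` forces it. [folklore] -/
theorem pos_of_asymptotic {c C θ : ℝ} (hθ : θ < 1)
    (h : ∀ B : ℕ, 1 ≤ B → |(mainCount B : ℝ) - c * B| ≤ C * (B : ℝ) ^ θ) : 0 < c := by
  obtain ⟨c₀, hc₀, B₀, hlow⟩ := exists_linear_le_mainCount
  by_contra hc
  push Not at hc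
  have h1θ : 0 < 1 - θ := by linarith
  have key : ∀ B : ℕ, max B₀ 1 ≤ B → c₀ * (B : ℝ) ^ (1 - θ) ≤ C := by
    intro B hB
    have hB1 : 1 ≤ B := le_of_max_le_right hB
    have hB0 : B₀ ≤ B := le_of_max_le_left hB
    have hBpos : (0 : ℝ) < B := by exact_mod_cast hB1
    have h1 := hlow B hB0
    have h2 := (abs_le.1 (h B hB1)).2
    have h4 : c * (B : ℝ) ≤ 0 := mul_nonpos_of_nonpos_of_nonneg hc hBpos.le
    have h5 : c₀ * (B : ℝ) ≤ C * (B : ℝ) ^ θ := by linarith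
    have hθpos : (0 : ℝ) < (B : ℝ) ^ θ := Real.rpow_pos_of_pos hBpos θ
    have e : (B : ℝ) ^ (1 - θ) = (B : ℝ) / (B : ℝ) ^ θ := by
      rw [Real.rpow_sub hBpos, Real.rpow_one]
    rw [e, mul_div_assoc', div_le_iff₀ hθpos]
    exact h5
  -- choose `B` with `B^{1-θ} > (|C| + 1)/c₀`
  obtain ⟨A, hA⟩ : ∃ A : ℝ, A = (|C| + 1) / c₀ := ⟨_, rfl⟩
  have hA0 : 0 < A := by rw [hA]; positivity
  obtain ⟨M, hM⟩ : ∃ M : ℝ, M = A ^ (1 / (1 - θ)) := ⟨_, rfl⟩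
  have hM0 : 0 ≤ M := by rw [hM]; exact Real.rpow_nonneg hA0.le _
  obtain ⟨B, hB⟩ : ∃ B : ℕ, B = max (max B₀ 1) (⌈M⌉₊ + 1) := ⟨_, rfl⟩
  have hBM : M < B := by
    have h1 : M ≤ ⌈M⌉₊ := Nat.le_ceil M
    have h2 : ((⌈M⌉₊ + 1 : ℕ) : ℝ) ≤ B := by rw [hB]; exact_mod_cast le_max_right _ _
    push_cast at h2
    linarith
  have hpow : A < (B : ℝ) ^ (1 - θ) := by
    calc A = M ^ (1 - θ) := by
          rw [hM, ← Real.rpow_mul hA0.le, one_div_mul_cancel h1θ.ne', Real.rpow_one]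
      _ < (B : ℝ) ^ (1 - θ) := Real.rpow_lt_rpow hM0 hBM h1θ
  have hkey := key B (by rw [hB]; exact le_max_left _ _)
  have hcA : c₀ * A = |C| + 1 := by rw [hA]; field_simp
  have hlt : c₀ * A < c₀ * (B : ℝ) ^ (1 - θ) := mul_lt_mul_of_pos_left hpow hc₀
  have hCabs : C ≤ |C| := le_abs_self C
  linarith

/-- **`c > 0` without Lemma 5.5.** Under Prop. 3.1 and the circle-method input (the shapes of
Theorem 4.2 and Lemma 4.15), the constant `c = cConst 𝔠` of the corrected (5.10) is positive —
because the asymptotic `N(B) = cB + O(B^{734/735+ε})` then holds and `N(B) ≫ B`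
(`exists_linear_le_mainCount`). In the source `c > 0` is Lemma 5.5 (local densities).
[cite: Shute2021, §5, Lemma 5.5 (conclusion only; different proof)] -/
theorem cConst_pos (h31 : Shute2021_prop31) {𝔠 : (Fin 4 → ℤ) → ℝ} (h1 : CoeffBound 𝔠)
    (h2 : CircleMethodInput 𝔠) : 0 < cConst 𝔠 := by
  obtain ⟨C, hC⟩ := mainCount_sub_linear_le_of_truncated' h31 (truncated_asymptotic h1 h2)
    (1 / 1470) (by norm_num)
  exact pos_of_asymptotic (θ := 734 / 735 + 1 / 1470) (by norm_num) hC

/-- **Theorem 1.1 of Shute (2021) from Prop. 3.1 and the circle-method input alone** — the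
hypothesis `0 < cConst 𝔠` of `theorem11_of_circleMethod` (Lemma 5.5) is discharged by
`cConst_pos`. What is thereby NOT formalized is exactly §4 (Theorem 4.2, Lemma 4.15) and
Prop. 3.1/3.2. [cite: Shute2021, Theorem 1.1; §5] -/
theorem theorem11_of_circleMethod' (h31 : Shute2021_prop31) (𝔠 : (Fin 4 → ℤ) → ℝ)
    (h1 : CoeffBound 𝔠) (h2 : CircleMethodInput 𝔠) : Shute2021_theorem11 :=
  theorem11_of_circleMethod h31 𝔠 h1 h2 (cConst_pos h31 h1 h2)

/-- The same from Prop. 3.2 (the paper's own logical structure; the printed proof of Prop. 3.2 is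
incomplete, see `ShuteFourSquareful.lean`). [cite: Shute2021, Theorem 1.1; §3, §5] -/
theorem theorem11_of_prop32_and_circleMethod' (h32 : Shute2021_prop32) (𝔠 : (Fin 4 → ℤ) → ℝ)
    (h1 : CoeffBound 𝔠) (h2 : CircleMethodInput 𝔠) : Shute2021_theorem11 :=
  theorem11_of_circleMethod' (Shute2021_prop32.prop31 h32) 𝔠 h1 h2

end Shute2021

end Literature.NumberTheory.DiophantineGeometry
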